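import Summits.ResolutionOfSingularities.ResolutionOfSingularities.Theorems.FrobeniusClosingPatchingRelPerfectDimFourRung
import Literature.Barriers.ResolutionOfSingularities.DimensionFourFrontier
import Literature.Barriers.ResolutionOfSingularities.AccessibleInDim
import Literature.AlgebraicGeometry.Resolution.Principalization
import Literature.AlgebraicGeometry.Resolution.RegularCentreBlowupSeqIntegral
import Literature.AlgebraicGeometry.Resolution.ArithmeticalThreefoldsBlowupFormDimThree
import Literature.AlgebraicGeometry.Resolution.ProperModelsPatching
import HarnessLib.Audit
import HarnessLib

/-!
# Crux `PatchingRelPerfect` (stmt-ResolutionOfSingularities-16161) — kill test K5.2 (slot W5.2,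
# LADDER-RESOLUTION L1): Piltant's (2013) dimension-3 patching hypotheses for `P = P_reg`, typed
# with the dimension as a parameter, against the crux's body and the tree's two-model patching

[OURS · L1 W5.2 · K5.2 ledger] A helper for the crux chain on `PatchingRelPerfect`; nothing here
is a statement of Hironaka's manuscript and no verdict on any paper is implied. AI review is
weaker than expert review.

The kill test (RESCUE-SEED row W5.2, verbatim): «type Piltant 2013's dim-3 patching hypotheses
against stmt-16161's body: is the dim ≥ 4 obstruction a missing THEOREM or a missing DEFINITION
(which «two models»)?». This file is the kernel-checked part of the answer; the reading (page
locators) is in `run/shared/lean/pub/res-hironaka/L/res-L1-k52/KILL-TEST-K5.2.md`.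

What is typed here, with the dimension `n` free (every statement below ELABORATES for `n = 4`):

* `PrincipalizationDim n` — Piltant's **Axiom 4** for `P = P_reg` = Cossart–Piltant 2008 Prop. 4.2
  = Cossart–Piltant 2019 Prop. 4.4, in the tree's regular-centre-sequence format, dimension `n`;
  `principalizationDim_three_iff`: at `n = 3` it is LITERALLY the tree's named fact
  `CossartPiltant2019Principalization` (undischarged, printed). At `n = 4` it is a statement with
  no printed proof in characteristic `p` (a missing THEOREM, not a missing definition).
* `DominatesBlowupsDim n` — the form in which Piltant's proof of Prop. 5.1 (Step 3, Lemma 5.3: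
  "after a modification `X₂' → X₂` with `π'⁻¹(Reg_P X₂) ⊆ Reg_P X₂'`, `η'` is factorizable above
  `x`") consumes the Zariski–Abhyankar factorization (CP 2008 Prop. 4.7) ONE DIMENSION UP: every
  blowing up of a regular excellent `n`-dimensional scheme along a non-zero ideal is DOMINATED by a
  Cossart–Piltant sequence of blowing ups along regular centres.
  `dominatesBlowupsDim_of_principalizationDim`: Axiom 4 in dimension `n` gives it (universal
  property of blowing up); `dominatesBlowupsDim_three`: hence it HOLDS in dimension `3` modulo the
  printed `CossartPiltant2019Principalization` — whereas the NAIVE lift of Prop. 4.7 (a FIXED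
  regular over-ring is accessible) is the tree's `AccessibleInDim`, TRUE for `n = 2` and REFUTED
  for `n = 3` (`naiveFactorization_two_and_not_three`, Sally 1972 / Shannon 1973 barrier). So the
  barrier `Sally1972_holds` refutes a statement the patching mechanism does not need.
* `AtomDimFour p` — the registered open core `stub_atomDimFour` of the line of record
  (`closed-point-slice` v3.2) as a NAMED statement: Cossart–Piltant 2019 Thm. 1.1 (ii)-format
  resolution of sandwiched fourfold germs over a complete regular local fourfold base with PERFECT
  residue field. `patchingRelPerfect_of_namedFacts_of_atomDimFour_of_dimGeFive`: the crux BY NAME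
  follows from the three printed dimension-`≤ 3` named facts, `∀ p, AtomDimFour p`, and the parked
  dimension-`≥ 5` residual; `zariskiPatching_four_perfect_of_namedFacts_of_atomDimFour`: the
  barrier's `ZariskiPatchingUpToDim 4`, perfect-field part, follows from the named facts and
  `AtomDimFour p`. Both are one-line assemblies of LANDED certificates (`…DimFourRung`,
  `…OfAtomDimFour`, `…CJSBlowupFormat`).
* «Which two models» — NOT re-typed here (already landed): the tree's
  `ProperModel.TwoModelPatching p` (Piltant 2013 Prop. 5.1 with `P = P_reg`; models
  `M₁ M₂ : ProperModel k K` of ONE function field `K/k`, output `N` with `φᵢ⁻¹(Reg Mᵢ) ⊆ Reg N`;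
  `Literature/AlgebraicGeometry/Resolution/ProperModelsPatching.lean`) is, modulo weak local
  uniformization, EQUIVALENT to resolution in characteristic `p`:
  `Theorems.resolutionInChar_iff_twoModelPatching_and_lu` (`ValuativePatchingReductions.lean`) =
  `Literature.….resolutionInChar_iff_twoModelPatching_and_lu` (`ZariskiPatchingProperModelsWeakLU.lean`);
  and `Theorems.patchingRelPerfect_of_twoModelPatchingPerfect` (crux BY NAME from two-model
  patching of proper models over perfect fields). The obstruction is that THEOREM, not a definition.

Deliberately NOT here: Piltant's Axioms 1, 2, 3, 6 (openness; stability under normalization and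
normalized point blow-ups; permissibilizing / regularizing CURVES by point blow-ups) — for
`P = P_reg` their printed proofs (Piltant 2013, Ex. 2.3 and Prop. 3.5 with `μ = 1`) are about
curves and are dimension-free as printed; they are internal to ONE proof of Prop. 5.1 and are not
hypotheses of the crux or of the tree's reduction; typing "stably `P`-permissible" (Def. 2.2)
would need vocabulary the tree does not have and the verdict does not need. Prop. 4.8 of CP 2008
(Zariski's Thm. 7) is Axiom 4 + Axiom 3 globalized; not typed separately.

## References

* O. Piltant, *An axiomatic version of Zariski's patching theorem*, RACSAM 107 (2013) 91–121
  (HAL hal-00612635): §2 Axioms 1–6, Thms. 2.4/2.5, Prop. 4.1/4.2, §5 Prop. 5.1 (Steps 1–5,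
  Def. 5.2, Lemmas 5.3/5.6), Cor. 5.7, §7 Problems 7.1/7.2. [Piltant2013]
* V. Cossart, O. Piltant, J. Algebra 320 (2008) 1051–1082, §4: Props. 4.1, 4.2, 4.7, 4.8, 4.9.
  [CossartPiltant2008]
* V. Cossart, O. Piltant, J. Algebra 529 (2019) (arXiv:1412.0868v1 Prop. 4.3/4.4 and the proof of
  Prop. 4.4, Step 3: "the following patching problem"). [CossartPiltant2019]
* J. Sally, Trans. AMS 171 (1972); D. Shannon, Amer. J. Math. 95 (1973). [Sally1972] [Shannon1973]
-/

-- `Summit.<Summit>.<Sub>.Theorems` with `Sub = Summit` (single-conjunct summit, D-0017)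
set_option linter.dupNamespace false

noncomputable section

open CategoryTheory CategoryTheory.Limits AlgebraicGeometry Literature.AlgebraicGeometry.Resolution
open Literature.Barriers.ResolutionOfSingularities

namespace Summit.ResolutionOfSingularities.ResolutionOfSingularities.Theorems

namespace K52

/-! ## Piltant's Axiom 4 for `P = P_reg`, dimension `n` -/

/-- **Piltant's Axiom 4 (principalization) for the usual regularity property, in dimension `n`**
[OURS · L1 W5.2 · K5.2 ledger]: on every regular, Noetherian, integral, excellent scheme `S` of
dimension `n`, every non-zero ideal sheaf `J` is principalized by a finite composition of blowing
ups along regular integral centres lying in the non-locally-principal loci of its transforms. This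
is the body of the tree's named fact `CossartPiltant2019Principalization` with `3` replaced by
`n` (`principalizationDim_three_iff`); Piltant 2013 p. 11: "That the usual regularity property
`P = P_reg` verifies axiom 4 in all characteristics is proved in proposition 4.2 of [12]" (= CP
2008, dimension three). For `n ≥ 4` and characteristic `p > 0` no proof is printed (Piltant 2013
p. 2; Cossart–Piltant 2019 §1); a statement, asserted nowhere.
[cite: Piltant2013, §2 Axiom 4 and §4.1; CossartPiltant2019, Prop. 4.4 (arXiv v1: Prop. 4.3)] -/
@[conjecture] def PrincipalizationDim (n : ℕ) : Prop :=
  ∀ (S : Scheme.{0}) [IsIntegral S] [IsNoetherian S], Scheme.IsRegular S → Scheme.IsExcellent S →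
    topologicalKrullDim S = n → ∀ J : S.IdealSheafData, J ≠ ⊥ →
      ∃ (S' : Scheme.{0}) (σ : S' ⟶ S), IsRegularCentreBlowupSeq σ J ∧ IsLocallyPrincipal (J.comap σ)

/-- At `n = 3`, `PrincipalizationDim 3` is LITERALLY the tree's named fact
`CossartPiltant2019Principalization` (Cossart–Piltant 2019, Prop. 4.4): classification (T3) —
the statement elaborates for every `n`, a proof is printed (and typed as a named fact) for
`n = 3` only. [cite: CossartPiltant2019, Prop. 4.4 (arXiv v1: Prop. 4.3)] -/
theorem principalizationDim_three_iff :
    PrincipalizationDim 3 ↔ CossartPiltant2019Principalization.{0} := by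
  simp only [PrincipalizationDim, CossartPiltant2019Principalization, Nat.cast_ofNat]

/-! ## CP 2008 Prop. 4.7 (Zariski–Abhyankar factorization) one dimension up: the naive lift is
refuted, the form the patching proof consumes is not -/

/-- **The NAIVE lift of CP 2008 Prop. 4.7 / Abhyankar's Thm. 3, dimension-indexed, is decided in
the tree both ways**: `AccessibleInDim 2` (Zariski–Abhyankar: every `2`-dimensional regular
local over-ring dominating a `2`-dimensional regular local ring of the same field is accessible)
HOLDS, and `AccessibleInDim 3` is FALSE (Sally 1972 Thm. 4.4 / Ex. 4.6 = Shannon's example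
`k[x,y,z]_{(x,y,z)} ⊂ k[t,y,z]_{(t,y,z)}`, `x = t(y²+z³)`). Classification (R4) for the naive
lift — but see `dominatesBlowupsDim_three`: the form Piltant's Lemma 5.3 uses survives.
[cite: CossartPiltant2008, Prop. 4.7; Sally1972, Thm. 4.4 and Ex. 4.6] -/
theorem naiveFactorization_two_and_not_three :
    AccessibleInDim.{0} 2 ∧ ¬ AccessibleInDim.{0} 3 :=
  ⟨accessibleInDim_two, not_accessibleInDim_three⟩

/-- **Domination of blowing ups by Cossart–Piltant sequences, dimension `n`** [OURS · L1 W5.2 ·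
K5.2 ledger]: for every regular, Noetherian, integral, excellent scheme `S` of dimension `n` and
every blowing up `f : T → S` of `S` along a non-zero ideal sheaf `I`, there are a finite
composition `σ : S' → S` of blowing ups along regular integral centres (in the non-principal loci
of the transforms of `I`) and a morphism `g : S' → T` over `S`. This is the shape in which
Piltant 2013, Lemma 5.3 ("there exists a projective birational morphism `π' : X₂' → X₂` … such
that `η'` is factorizable above `x`") consumes the Zariski–Abhyankar factorization at the local
ring of a curve: the given model may first be MODIFIED. One dimension up (local rings of curves
on fourfolds have dimension `3`) this is the `n = 3` instance. A statement, asserted nowhere.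
[cite: Piltant2013, Def. 5.2 and Lemma 5.3; CossartPiltant2008, Prop. 4.8 (proof)] -/
@[conjecture] def DominatesBlowupsDim (n : ℕ) : Prop :=
  ∀ (S : Scheme.{0}) [IsIntegral S] [IsNoetherian S], Scheme.IsRegular S → Scheme.IsExcellent S →
    topologicalKrullDim S = n → ∀ (T : Scheme.{0}) (f : T ⟶ S) (I : S.IdealSheafData),
      I ≠ ⊥ → IsBlowup f I →
        ∃ (S' : Scheme.{0}) (σ : S' ⟶ S) (g : S' ⟶ T), IsRegularCentreBlowupSeq σ I ∧ g ≫ f = σ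

/-- **Axiom 4 in dimension `n` gives domination of blowing ups in dimension `n`** (universal
property of blowing up, Görtz–Wedhorn Def. 13.90): principalize `I` by `σ : S' → S`; along a
Cossart–Piltant sequence over an integral Noetherian scheme `S'` is integral and `I𝒪_{S'} ≠ 0`
(`IsRegularCentreBlowupSeq.isIntegral_and_comap_ne_bot`), so the locally principal `I𝒪_{S'}`
is an effective Cartier divisor (`IsLocallyPrincipal.isEffectiveCartier_of_ne_bot`) and `σ`
factors through the blowing up `f`. [folklore] -/
theorem dominatesBlowupsDim_of_principalizationDim (n : ℕ) (hP : PrincipalizationDim n) :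
    DominatesBlowupsDim n := by
  intro S _ _ hreg hexc hdim T f I hI hf
  obtain ⟨S', σ, hσ, hprin⟩ := hP S hreg hexc hdim I hI
  have hne : I.comap σ ≠ ⊥ :=
    (hσ.isIntegral_and_comap_ne_bot inferInstance inferInstance hI).2.2
  haveI : IsIntegral S' := hσ.isIntegral hI
  have hcart : IsEffectiveCartier (I.comap σ) := hprin.isEffectiveCartier_of_ne_bot hne
  exact ⟨S', σ, hf.lift σ hcart, hσ, hf.lift_comp σ hcart⟩

/-- **In dimension `3` the modifiable factorization HOLDS modulo the printed
`CossartPiltant2019Principalization`** — the dimension in which a patching argument for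
FOURFOLDS would consume it at the local rings of curves. Together with
`naiveFactorization_two_and_not_three`: the Sally–Shannon barrier refutes the naive lift of
CP 2008 Prop. 4.7, not the input of Piltant's Lemma 5.3 one dimension up. A CONDITIONAL result
(named-fact hypothesis). [cite: CossartPiltant2019, Prop. 4.4; Piltant2013, Lemma 5.3] -/
theorem dominatesBlowupsDim_three (hP : CossartPiltant2019Principalization.{0}) :
    DominatesBlowupsDim 3 :=
  dominatesBlowupsDim_of_principalizationDim 3 (principalizationDim_three_iff.mpr hP)

/-! ## The missing THEOREM in dimension 4, named, and what it closes -/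

/-- **T(4) — the dimension-4 atom of the line of record `closed-point-slice` (registered stub
`stub_atomDimFour`), as a named statement** [OURS · L1 W5.2 · K5.2 ledger]: for a complete
regular local ring `S` of dimension `4`, characteristic `p`, PERFECT residue field
(`S ≅ κ[[x₁,…,x₄]]`), and an integral `T` proper and birational over `Spec S`, regular off the
closed fibre, there is a non-zero ideal sheaf on `T`, cosupported in the closed fibre, whose
blowing up is regular — Cossart–Piltant 2019 Thm. 1.1 (ii)-format resolution of sandwiched
fourfold germs ("Cossart–Piltant one dimension up", printed as OPEN: Piltant 2013 p. 2,
Cossart–Piltant 2019 §1). Verbatim the hypothesis `hA4 p` of the landed certificates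
`punctualCompletePerfect_four_of_printed_of_atomDimFour` /
`zariskiPatchingUpToDim_four_perfect_of_printed_of_atomDimFour`. A statement, asserted nowhere.
[cite: CossartPiltant2019, Thm. 1.1 (ii) (the dimension-3 model); Piltant2013, p. 2] -/
@[conjecture] def AtomDimFour (p : ℕ) : Prop :=
  ∀ (S : Type) [CommRing S] [IsRegularLocalRing S] [CharP S p]
    [IsAdicComplete (IsLocalRing.maximalIdeal S) S]
    [PerfectField (IsLocalRing.ResidueField S)], ringKrullDim S = (4 : ℕ) →
    ∀ (T : Scheme.{0}) (f : T ⟶ Spec (.of S)), IsIntegral T → IsProper f → IsBirational f →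
      (∀ t : T, f.base t ≠ IsLocalRing.closedPoint S → IsRegularLocalRing (T.presheaf.stalk t)) →
      ∃ (J : T.IdealSheafData) (T' : Scheme.{0}) (π : T' ⟶ T), J ≠ ⊥ ∧
        (∀ t : T, t ∈ J.support → f.base t = IsLocalRing.closedPoint S) ∧
        IsBlowup π J ∧ Scheme.IsRegular T'

/-- **T(4) closes the dimension-4 slot of the patching door over perfect fields**: from the three
printed dimension-`≤ 3` NAMED FACTS (`CossartPiltant2019General`,
`CossartPiltant2019Principalization`, `CossartJannsenSaito2020Sequence`) and `AtomDimFour p`, the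
perfect-field part of the barrier's `ZariskiPatchingUpToDim 4` at characteristic `p` follows:
`∀ k` perfect of characteristic `p`, `ResolutionOverUpToDim k 3 → LocalUniformizationUpToDim k 4
→ ResolutionOverUpToDim k 4`. One-line assembly of the landed W3 rung
(`zariskiPatchingUpToDim_four_perfect_of_printed_of_atomDimFour`) with the CJS single-blow-up
format (`cjs2020BlowupFormat_of_cossartJannsenSaito2020Sequence`). CONDITIONAL.
[cite: CossartPiltant2019, Thm. 1.1 and Prop. 4.4; CossartJannsenSaito2020, Thm. 1.2; Piltant2013, Prop. 5.1 and Cor. 5.7] -/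
theorem zariskiPatching_four_perfect_of_namedFacts_of_atomDimFour (p : ℕ) (hp : p.Prime)
    (hG : CossartPiltant2019General.{0}) (hP : CossartPiltant2019Principalization.{0})
    (hS : CossartJannsenSaito2020Sequence.{0}) (hT4 : AtomDimFour p) :
    ∀ (k : Type) [Field k] [CharP k p] [PerfectField k],
      ResolutionOverUpToDim.{0} k 3 → LocalUniformizationUpToDim.{0} k 4 →
        ResolutionOverUpToDim.{0} k 4 :=
  zariskiPatchingUpToDim_four_perfect_of_printed_of_atomDimFour p hp hG hP
    (cjs2020BlowupFormat_of_cossartJannsenSaito2020Sequence hS) hT4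

/-- **T(4) for every prime, plus the parked dimension-`≥ 5` residual, closes the crux BY NAME**
(`Theses.FrobeniusClosing.PatchingRelPerfect`, the same term as `Theses.ShadowGame.PatchingRelPerfect`,
stmt-ResolutionOfSingularities-16161) over the three printed NAMED FACTS: one-line assembly of
the landed certificate `patchingRelPerfect_of_printed_of_atomDimFour_of_dimGeFive` with the CJS
single-blow-up format. So after K5.2 the dimension-`≥ 4` content of the crux is the THEOREM-shaped
pair (`∀ p, AtomDimFour p`, residual in dimension `≥ 5`), not a definition. CONDITIONAL; the item
stays open. [cite: CossartPiltant2019, Thm. 1.1 and Prop. 4.4; CossartJannsenSaito2020, Thm. 1.2; Piltant2013, p. 2] -/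
theorem patchingRelPerfect_of_namedFacts_of_atomDimFour_of_dimGeFive
    (hG : CossartPiltant2019General.{0}) (hP : CossartPiltant2019Principalization.{0})
    (hS : CossartJannsenSaito2020Sequence.{0}) (hT4 : ∀ p : ℕ, p.Prime → AtomDimFour p)
    (h5 : ∀ (p : ℕ), p.Prime →
      (∀ (k K : Type) [Field k] [CharP k p] [PerfectField k] [Field K] [Algebra k K],
        (⊤ : IntermediateField k K).FG → ∀ O : ValuationSubring K, (∀ c : k, algebraMap k K c ∈ O) →
          ∀ R : Subalgebra k K, R.FG → R.toSubring ≤ O.toSubring →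
            ∃ (A : Subalgebra k K) (h : A.toSubring ≤ O.toSubring), R ≤ A ∧ A.FG ∧
              IsFractionRing A K ∧ IsRegularLocalRing (Localization.AtPrime
                (Ideal.comap (Subring.inclusion h) (IsLocalRing.maximalIdeal O)))) →
      ∀ (k : Type) [Field k] [CharP k p] [PerfectField k] (X : Scheme.{0}) (f : X ⟶ Spec (.of k)),
        IsSeparated f → LocallyOfFiniteType f → QuasiCompact f → IsIntegral X →
        ¬ topologicalKrullDim X ≤ 4 → Scheme.HasResolution X) :
    Summit.ResolutionOfSingularities.ResolutionOfSingularities.Theses.FrobeniusClosing.PatchingRelPerfect :=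
  patchingRelPerfect_of_printed_of_atomDimFour_of_dimGeFive hG hP
    (cjs2020BlowupFormat_of_cossartJannsenSaito2020Sequence hS) hT4 h5

end K52

end Summit.ResolutionOfSingularities.ResolutionOfSingularities.Theorems

end
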